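import Mathlib
import HarnessLib
import Summits.HubbardSuperconductivity.HubbardSuperconductivity.Theorems.KLProgrammeKLRegimeEngineV8PairTransferExport5
import Summits.HubbardSuperconductivity.HubbardSuperconductivity.Theorems.KLProgrammeKLRegimeEngineV8DefsG10Hosting

/-!
# Route `KLProgramme` — ENGINE child gen 8 (stmt-HubbardSuperconductivity-20437 `KLRegimeEngineV17F2`), skeleton-v2 export class #5 «(S)-transfer», names-only LAYER
# «Export6» = Export5 ∘ ONE CONJUNCT in the package predicate: the NUMERIC CAP the (E2-F2) consumer needs (located defect «(X).3-CAP-MISSING», KL STATUS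
# 2026-08-28 ≈01:50Z, rulings (R96)/(R97)/(R99); cell gate-hubbard-kl, seat hubbard-kl-k3c2-p2 g14 — the Export6 TEXT OF RECORD)

WHY.  Stub (c)'s `htr` binder reads the class-#5 family at the DEFERRED constant `klCT5 P R (klEngQ7 P R)`; step 3 hosts the pinned pair into `transferBarAt … r′ …` with
`r′ ≥ 2·klCT5·15367` (`pairTransferPinnedAt_compl_of_relIdx_klEngGeo10`), and `pairLadderStepAtV17F2_of_pairTransferPinnedAt`'s `E₁`-budget then needs `r′` NUMERICALLY
small against the frozen (E2-F2)ₙ slot (ph slots `phGain (n−1) ≤ 4·phGain n`, thermal `thermalBar (n−1) = thermalBar n/4`; same `G` on both sides).  But `IsTransferPkg4`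
carries no cap and `PairTransferStep5 … r u` holds for every `r ≥ r₀` once it holds at `r₀`, so `Classical.choose` yields no bound on `klCT5`.  This layer adds the cap
to the admissibility predicate — the producer's witness must satisfy `r ≤ klCTcap`, the consumer reads `klCT6_le_klCTcap` — and hosts the pinned pair at the NUMERIC
prefactor `klCTpin := 30734·klCTcap` at the token `klEngGeo10`.  SECOND («(X).3-∀G»): `PairTransferStep5 := ∀ G, G.WF → …` with G-blind `(r, u)` while the
relative bar's thermal slot `r·thermalBar G·ms = r·G.CF·(…)` is G-KEYED — the producer's G-independent thermal-layer defect cannot sit in it for EVERY well-formed `G`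
(no guard relates `r` to `G.CF`, unlike `E4FlowAt`'s `E ≤ G.cE4`); so the step of this layer takes `G` as a PARAMETER (`PairTransferStep6 P R Q₀ G r u`, body =
Step5's at that `G`), composed at the token; the deferred package is keyed `(P R Q₀ G)`.
* §1 **`klCTcap := 1/2¹⁹`** (plan g21 (R97)(1); `klCTpin = 30734/2¹⁹ < 1/16`),
  **`klCTpin := 30734·klCTcap`**, `klCTpin_lt : klCTpin < 1/16`, signs;
* §2 **`PairTransferStep6 P R Q₀ G r u`** := `PairTransferStep5`'s body with `G` a PARAMETER (`G.WF →` first binder; everything else byte-verbatim); `PairTransferStep5.toStep6`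
  (a `∀ G` step gives the step at every `G`); **`IsTransferPkg6 e := 0 ≤ e.1 ∧ e.1 ≤ klCTcap ∧ ∀ Q cc, 0 < e.2 Q cc`**, `.toPkg4`, `isTransferPkg6_zero`; deferred
  **`klTransferPkg6 / klCT6 / klCTu6`** keyed `(P R Q₀ G)` (default `(0, 1)`), `klCT6_nonneg`, **`klCT6_le_klCTcap`**, `klCTu6_pos`, `pairTransferStep6_klCT6_of_exists / _of`;
* §3 the unroll `pairTransferRelFamilyK5_all_of_step6` (G-parametric twin of `…_all_of_step5`) and §C's line `pairTransferRelFamilyK5_klCT6_all_of_exists`;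
* §4 the (c)-closer's step-3 input BY NAME with the numeric prefactor: **`pairTransferPinnedAt_klCTpin_of_relIdx_klEngGeo10`** (`0 ≤ P.Klam`).
RENDER DELTA (rev 12 candidate): (X).3 `∃ e, IsTransferPkg6 e ∧ PairTransferStep6 P R (klEngQ7 P R) klEngGeo10 e.1 e.2`; (c) `htr` keyed
`klCT6 P R (klEngQ7 P R) klEngGeo10`; §C `pairTransferRelFamilyK5_klCT6_all_of_exists h5 …`; #14 (U12b) entry `klCTu6 P R (klEngQ7 P R) klEngGeo10 (klEngQ9c P R) cc`.
Definitions with bodies + order lemmas; nothing about the model is asserted; nothing asserts superconductivity.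
-/

noncomputable section

namespace Summit.HubbardSuperconductivity.HubbardSuperconductivity.Theorems.EngineV8

set_option linter.dupNamespace false -- summit = problem name (single-conjunct summit), D-0017

open Real Finset Literature.MathematicalPhysics.QuantumLattice Literature.Probability.LatticeModels
open Literature.MathematicalPhysics.QuantumLattice.FermiRG
open Summit.HubbardSuperconductivity.HubbardSuperconductivity.Theorems.KLProgrammeLegKernels
open Summit.HubbardSuperconductivity.HubbardSuperconductivity.Theorems.DispersionFlow
open Summit.HubbardSuperconductivity.HubbardSuperconductivity.Theorems.KLRegimeSplit

/-! ## §1 The cap and the pinned prefactor (numerals) -/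

/-- **`klCTcap := 1/2¹⁹`** — the numeric cap on the class-#5 relative prefactor (plan g21 (R97)(1): `klCTpin = 30734/2¹⁹ < 1/16`). -/
def klCTcap : ℝ := 1 / 2 ^ 19

/-- **`klCTpin := 30734·klCTcap`** — the hosted PINNED prefactor (`2·15367·r ≤ klCTpin` for every capped `r`). -/
def klCTpin : ℝ := 30734 * klCTcap

/-- `klCTcap = 1/2¹⁹`. -/
theorem klCTcap_eq : klCTcap = 1 / 2 ^ 19 := rfl
/-- `0 < klCTcap`. -/
theorem klCTcap_pos : 0 < klCTcap := by unfold klCTcap; positivity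
/-- `klCTpin = 30734·klCTcap`. -/
theorem klCTpin_eq : klCTpin = 30734 * klCTcap := rfl
/-- `0 < klCTpin`. -/
theorem klCTpin_pos : 0 < klCTpin := by unfold klCTpin; have := klCTcap_pos; positivity
/-- **`klCTpin < 1/16`** (`30734 < 2¹⁵ = 2¹⁹/16`). -/
theorem klCTpin_lt : klCTpin < 1 / 16 := by
  unfold klCTpin klCTcap; norm_num
/-- `klCTpin ≤ 1/16`. -/
theorem klCTpin_le : klCTpin ≤ 1 / 16 := klCTpin_lt.le

/-! ## §2 The G-parametric step, the capped admissibility predicate and the deferred package -/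

/-- **`PairTransferStep6 P R Q₀ G r u`** — class #5's induction step AT THE PACKAGE `G` (a parameter; `G.WF` the first binder): `PairTransferStep5`'s body byte-verbatim
otherwise (every raise `Q` of `Q₀`, `0 < cc ≤ klEngC₃6 P R`, `μ ∈ klWindowC`, `0 < U ≤ klEngU₀10 P R cc`, `U ≤ u Q cc`, `klBetaMin ≤ β ≤ e^{cc/U²}`, `klEngL₄ P R β U ≤ L`,
`klEngM₃ β U L ≤ M`, `n ≤ nScales β + 1`, `IsKLRegime`, the public history AT `(G, Q)`, the admissibility of `Kₙ`, the class-#1 merged exports at every `j ≤ n`, the K5 families at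
every `j < n` ⟹ the K5 family at `n`).  Composed at the token `G := klEngGeo10`, where `CF ≥ 2⁸⁰` gives the bar's thermal slot its room. -/
def PairTransferStep6 (P : SplitConsts) (R : RenConsts) (Q₀ : EngConsts) (G : GeoConsts) (r : ℝ) (u : EngConsts → ℝ → ℝ) : Prop :=
  G.WF → ∀ Q : EngConsts, Q₀.IsRaiseOf Q →
    ∀ cc : ℝ, 0 < cc → cc ≤ klEngC₃6 P R →
      ∀ μ ∈ klWindowC, ∀ U : ℝ, 0 < U → U ≤ klEngU₀10 P R cc → U ≤ u Q cc →
        ∀ β : ℝ, klBetaMin ≤ β → β ≤ Real.exp (cc / U ^ 2) →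
          ∀ (L M : ℕ) [NeZero L] [NeZero M], klEngL₄ P R β U ≤ L → klEngM₃ β U L ≤ M →
            ∀ n : ℕ, n ≤ nScales β + 1 → IsKLRegime U cc (-(n : ℤ)) →
              HistP klPredsV17F2 L M G P Q R β U μ 0 n →
                FrameOK R U (nScales β) μ (klFlowFrameU L M β U μ n) →
                  (∀ j ≤ n, LevelsUExportMixedAt L M (klCU2 P R Q₀) P β U μ j) →
                    (∀ j < n, PairTransferRelFamilyK5 L M G P r β U μ j) →
                      PairTransferRelFamilyK5 L M G P r β U μ n

/-- A `∀ G` step (rev 3 / Export5) gives the G-parametric step at every `G`. -/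
theorem PairTransferStep5.toStep6 {P : SplitConsts} {R : RenConsts} {Q₀ : EngConsts} {r : ℝ} {u : EngConsts → ℝ → ℝ} (h : PairTransferStep5 P R Q₀ r u)
    (G : GeoConsts) : PairTransferStep6 P R Q₀ G r u :=
  fun hG => h G hG

/-- **An admissible class-#5 package WITH THE CAP**: `0 ≤ r ≤ klCTcap` and a coupling threshold positive at every raised package. -/
def IsTransferPkg6 (e : ℝ × (EngConsts → ℝ → ℝ)) : Prop := 0 ≤ e.1 ∧ e.1 ≤ klCTcap ∧ ∀ Q cc, 0 < e.2 Q cc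

/-- A capped package is a rev-3 package. -/
theorem IsTransferPkg6.toPkg4 {e : ℝ × (EngConsts → ℝ → ℝ)} (h : IsTransferPkg6 e) : IsTransferPkg4 e := ⟨h.1, h.2.2⟩

/-- The trivial package `(0, 1)` is capped-admissible. -/
theorem isTransferPkg6_zero : IsTransferPkg6 (0, fun _ _ => 1) := ⟨le_rfl, klCTcap_pos.le, fun _ _ => one_pos⟩

section Deferred

variable (P : SplitConsts) (R : RenConsts) (Q₀ : EngConsts) (G : GeoConsts)

/-- **The deferred CAPPED transfer package at `G`**: SOME capped-admissible `(r, u)` with `PairTransferStep6 P R Q₀ G r u`, if one exists, else `(0, 1)`. -/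
def klTransferPkg6 : ℝ × (EngConsts → ℝ → ℝ) :=
  open scoped Classical in
  if h : ∃ e : ℝ × (EngConsts → ℝ → ℝ), IsTransferPkg6 e ∧ PairTransferStep6 P R Q₀ G e.1 e.2 then Classical.choose h else (0, fun _ _ => 1)

/-- **`klCT6 P R Q₀ G`** — the deferred capped transfer constant (stub (c)'s `htr` reads it at `(Q₀, G) = (klEngQ7 P R, klEngGeo10)`). -/
def klCT6 : ℝ := (klTransferPkg6 P R Q₀ G).1

/-- **`klCTu6 P R Q₀ G`** — the deferred coupling threshold (U12b's class-#5 `min` entry at `(klEngQ9c P R, cc)`). -/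
def klCTu6 : EngConsts → ℝ → ℝ := (klTransferPkg6 P R Q₀ G).2

/-- The deferred package is capped-admissible (unconditionally). -/
theorem isTransferPkg6_klTransferPkg6 : IsTransferPkg6 (klTransferPkg6 P R Q₀ G) := by
  classical
  unfold klTransferPkg6
  split_ifs with h
  · exact (Classical.choose_spec h).1
  · exact isTransferPkg6_zero

/-- `0 ≤ klCT6 P R Q₀ G`. -/
theorem klCT6_nonneg : 0 ≤ klCT6 P R Q₀ G := (isTransferPkg6_klTransferPkg6 P R Q₀ G).1

/-- **`klCT6 P R Q₀ G ≤ klCTcap`** — what the (E2-F2) consumer reads. -/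
theorem klCT6_le_klCTcap : klCT6 P R Q₀ G ≤ klCTcap := (isTransferPkg6_klTransferPkg6 P R Q₀ G).2.1

/-- **The hosting prefactor inequalities**: `2·klCT6·15367 ≤ klCTpin` and `2·klCT6·15367 ≤ klCTpin·2⁵²`. -/
theorem two_mul_klCT6_mul_le_klCTpin : 2 * klCT6 P R Q₀ G * 15367 ≤ klCTpin := by
  have h := klCT6_le_klCTcap P R Q₀ G
  have h0 := klCT6_nonneg P R Q₀ G
  unfold klCTpin
  nlinarith

/-- `2·klCT6·15367 ≤ klCTpin·2⁵²`. -/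
theorem two_mul_klCT6_mul_le_klCTpin_mul : 2 * klCT6 P R Q₀ G * 15367 ≤ klCTpin * 2 ^ 52 := by
  refine (two_mul_klCT6_mul_le_klCTpin P R Q₀ G).trans ?_
  have := klCTpin_pos
  nlinarith

/-- `0 < klCTu6 P R Q₀ G Q cc`. -/
theorem klCTu6_pos (Q : EngConsts) (cc : ℝ) : 0 < klCTu6 P R Q₀ G Q cc := (isTransferPkg6_klTransferPkg6 P R Q₀ G).2.2 Q cc

variable {P R Q₀ G}

/-- **The step holds for the deferred capped package as soon as it holds for some capped-admissible package** (how §C reads (X).3 under Export6). -/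
theorem pairTransferStep6_klCT6_of_exists (h : ∃ e : ℝ × (EngConsts → ℝ → ℝ), IsTransferPkg6 e ∧ PairTransferStep6 P R Q₀ G e.1 e.2) :
    PairTransferStep6 P R Q₀ G (klCT6 P R Q₀ G) (klCTu6 P R Q₀ G) := by
  classical
  have hpkg : klTransferPkg6 P R Q₀ G = Classical.choose h := by
    unfold klTransferPkg6
    rw [dif_pos h]
  unfold klCT6 klCTu6
  rw [hpkg]
  exact (Classical.choose_spec h).2

/-- Packaging an explicit witness (`0 ≤ r ≤ klCTcap`, `u > 0`). -/
theorem pairTransferStep6_klCT6_of {r : ℝ} {u : EngConsts → ℝ → ℝ} (hr : 0 ≤ r) (hrc : r ≤ klCTcap) (hu : ∀ Q cc, 0 < u Q cc)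
    (hs : PairTransferStep6 P R Q₀ G r u) : PairTransferStep6 P R Q₀ G (klCT6 P R Q₀ G) (klCTu6 P R Q₀ G) :=
  pairTransferStep6_klCT6_of_exists ⟨(r, u), ⟨hr, hrc, hu⟩, hs⟩

/-- From a `∀ G` (Export5-shape) witness with the cap. -/
theorem pairTransferStep6_klCT6_of_step5 {r : ℝ} {u : EngConsts → ℝ → ℝ} (hr : 0 ≤ r) (hrc : r ≤ klCTcap) (hu : ∀ Q cc, 0 < u Q cc)
    (hs : PairTransferStep5 P R Q₀ r u) : PairTransferStep6 P R Q₀ G (klCT6 P R Q₀ G) (klCTu6 P R Q₀ G) :=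
  pairTransferStep6_klCT6_of hr hrc hu (hs.toStep6 G)

end Deferred

/-! ## §3 The unroll at the deferred capped package (the term §C's `htr` line calls) -/

section Unroll

variable {P : SplitConsts} {R : RenConsts} {Q₀ Q : EngConsts} {G : GeoConsts} {cc μ U β : ℝ} {L M : ℕ} [NeZero L] [NeZero M]

/-- **CLASS #5 UNROLLED from the G-parametric step**: `PairTransferStep6 P R Q₀ G r u`, `G.WF`, a raise `Q` of `Q₀`, the v2 binders, the bare frame's admissibility
`h0`, `R.WF2`, the public history up to `n ≤ n_β + 1` AT `(G, Q)` and the class-#1 merged exports at every `j ≤ n` ⟹ the K5 family at every `j ≤ n`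
(argument list = `pairTransferRelFamilyK5_all_of_step5`'s verbatim). -/
theorem pairTransferRelFamilyK5_all_of_step6 {r : ℝ} {u : EngConsts → ℝ → ℝ} (hstep : PairTransferStep6 P R Q₀ G r u) (hG : G.WF) (hQ : Q₀.IsRaiseOf Q)
    (hcc0 : 0 < cc) (hcc : cc ≤ klEngC₃6 P R) (hμ : μ ∈ klWindowC) (h0 : FrameOK R U (nScales β) μ 0) (hU : 0 < U) (hU10 : U ≤ klEngU₀10 P R cc)
    (hUu : U ≤ u Q cc) (hβ : klBetaMin ≤ β) (hβc : β ≤ Real.exp (cc / U ^ 2)) (hL : klEngL₄ P R β U ≤ L) (hM : klEngM₃ β U L ≤ M) (hR : R.WF2)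
    {n : ℕ} (hn : n ≤ nScales β + 1) (hhist : HistP klPredsV17F2 L M G P Q R β U μ 0 n)
    (hlev : ∀ j ≤ n, LevelsUExportMixedAt L M (klCU2 P R Q₀) P β U μ j) : ∀ j ≤ n, PairTransferRelFamilyK5 L M G P r β U μ j :=
  exports_all_of_step₂ (E := fun j => LevelsUExportMixedAt L M (klCU2 P R Q₀) P β U μ j) (F := fun j => PairTransferRelFamilyK5 L M G P r β U μ j) (N := n)
    hlev
    (fun m hm hE hist => by
      have hmn : m ≤ nScales β + 1 := hm.trans hn
      have hhm : HistP klPredsV17F2 L M G P Q R β U μ 0 m := histP_klPredsV17F2_of_le hhist hm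
      exact hstep hG Q hQ cc hcc0 hcc μ hμ U hU hU10 hUu β hβ hβc L M hL hM m hmn (isKLRegime_of_le_nScales_succ hcc0.le hβ hβc hmn) hhm
        (frameOK_klFlowFrameU_of_histP hR h0 hmn hhm) hE hist)
    n le_rfl

/-- **CLASS #5 UNROLLED at the deferred capped package** (§C's `htr` line under Export6): from `∃ e, IsTransferPkg6 e ∧ PairTransferStep6 P R Q₀ G e.1 e.2`, under the same
binders with `U ≤ klCTu6 P R Q₀ G Q cc`: `PairTransferRelFamilyK5 L M G P (klCT6 P R Q₀ G) β U μ j` at every `j ≤ n`. -/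
theorem pairTransferRelFamilyK5_klCT6_all_of_exists (hex : ∃ e : ℝ × (EngConsts → ℝ → ℝ), IsTransferPkg6 e ∧ PairTransferStep6 P R Q₀ G e.1 e.2) (hG : G.WF)
    (hQ : Q₀.IsRaiseOf Q) (hcc0 : 0 < cc) (hcc : cc ≤ klEngC₃6 P R) (hμ : μ ∈ klWindowC) (h0 : FrameOK R U (nScales β) μ 0) (hU : 0 < U)
    (hU10 : U ≤ klEngU₀10 P R cc) (hUu : U ≤ klCTu6 P R Q₀ G Q cc) (hβ : klBetaMin ≤ β) (hβc : β ≤ Real.exp (cc / U ^ 2)) (hL : klEngL₄ P R β U ≤ L)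
    (hM : klEngM₃ β U L ≤ M) (hR : R.WF2) {n : ℕ} (hn : n ≤ nScales β + 1) (hhist : HistP klPredsV17F2 L M G P Q R β U μ 0 n)
    (hlev : ∀ j ≤ n, LevelsUExportMixedAt L M (klCU2 P R Q₀) P β U μ j) : ∀ j ≤ n, PairTransferRelFamilyK5 L M G P (klCT6 P R Q₀ G) β U μ j :=
  pairTransferRelFamilyK5_all_of_step6 (pairTransferStep6_klCT6_of_exists hex) hG hQ hcc0 hcc hμ h0 hU hU10 hUu hβ hβc hL hM hR hn hhist hlev

end Unroll

/-! ## §4 Step 3's input BY NAME: the pinned pair at the NUMERIC prefactor `klCTpin`, at the token `klEngGeo10` -/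

section Pinned

open Summit.HubbardSuperconductivity.HubbardSuperconductivity.Theorems.KLRegimeSplit

variable {L M : ℕ} [NeZero L] [NeZero M]

/-- **The pinned pair `(s_{n,m} | s_{n,n})` of the family at `klCT6` gives `PairTransferPinnedAt L M klEngGeo10 P klCTpin β U μ n (s_{n,m})`** (`0 ≤ P.Klam`) —
`pairTransferPinnedAt_compl_of_relIdx_klEngGeo10` with `r := klCT6 P R Q₀ G` (any key `G`; at composition `G = klEngGeo10`), `r′ := klCTpin` (`2r·15367 ≤ klCTpin`, `≤ klCTpin·2⁵²`). -/
theorem pairTransferPinnedAt_klCTpin_of_relIdx_klEngGeo10 {P : SplitConsts} (hK : 0 ≤ P.Klam) {R : RenConsts} {Q₀ : EngConsts} {G : GeoConsts} {β U μ : ℝ}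
    {n m : ℕ}
    (h : PairTransferRelAt L M β U μ n (transferBarRelIdx L klEngGeo10 P (klCT6 P R Q₀ G) β U n n)
      (softSymbolCompl L M β μ (klFlowFrameU L M β U μ n) n m) (softSymbolCompl L M β μ (klFlowFrameU L M β U μ n) n n)) :
    PairTransferPinnedAt L M klEngGeo10 P klCTpin β U μ n (softSymbolCompl L M β μ (klFlowFrameU L M β U μ n) n m) :=
  pairTransferPinnedAt_compl_of_relIdx_klEngGeo10 hK (klCT6_nonneg P R Q₀ G) (two_mul_klCT6_mul_le_klCTpin P R Q₀ G)
    (two_mul_klCT6_mul_le_klCTpin_mul P R Q₀ G) h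

/-- **The same from the family**: `PairTransferRelFamilyK5 L M klEngGeo10 P (klCT6 P R Q₀ G) β U μ n`, `n ≤ m ≤ n_β + 1` ⟹
`PairTransferPinnedAt L M klEngGeo10 P klCTpin β U μ n (s_{n,m})`. -/
theorem PairTransferRelFamilyK5.pinnedAt_klCTpin {P : SplitConsts} (hK : 0 ≤ P.Klam) {R : RenConsts} {Q₀ : EngConsts} {G : GeoConsts} {β U μ : ℝ} {n : ℕ}
    (h : PairTransferRelFamilyK5 L M klEngGeo10 P (klCT6 P R Q₀ G) β U μ n) {m : ℕ} (hnm : n ≤ m) (hm : m ≤ nScales β + 1) :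
    PairTransferPinnedAt L M klEngGeo10 P klCTpin β U μ n (softSymbolCompl L M β μ (klFlowFrameU L M β U μ n) n m) :=
  pairTransferPinnedAt_klCTpin_of_relIdx_klEngGeo10 hK (h m n le_rfl hnm hm)

end Pinned

end Summit.HubbardSuperconductivity.HubbardSuperconductivity.Theorems.EngineV8

end
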